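import Summits.Schanuel.Schanuel.Theses.ArithmeticalComplexity
import Literature.NumberTheory.Transcendental.OneMotiveToric
import Literature.Barriers.Schanuel.AlgebraicIndependenceOfLogarithms

/-!
# Strategy census for the deciding crux `ComputableSchanuel` (stmt-Schanuel-4023) — typed candidates

Crux-strategist `cstrat-stmt-Schanuel-4023-r1` (route `route-Schanuel-ArithmeticalComplexity`, re-audit bin
RESTATED).  This file TYPES the candidate decompositions `X₁ ∧ … ∧ X_k → ComputableSchanuel` examined in
`STRATEGY-CENSUS.md` and proves, sorry-free, the assemblies (b) and the collapses that decide (c):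

* `D1` (keys bridge, the route's own Π⁰₁-descent promoted to a split): `KeysZM`, `KeysBridge`,
  assembly `computableSchanuel_of_keys`, collapse `keysBridge_of_schanuel`.
* `D3` (complexity sub-class): `PrimrecSchanuel`, `CorePrimrec`, assembly `computableSchanuel_of_primrec`,
  collapse `primrecSchanuel_of_computableSchanuel` — the judge's `smuggling` shape one level down.
* `D4` (stratification by length): `SchanuelUpTo`, `SchanuelAbove`, the PADDING LEMMA
  `schanuelAt_of_succ : SchanuelAt (n+1) → SchanuelAt n` (adjoin a root of unity outside the ℚ-span) and
  `schanuel_of_schanuelAbove : SchanuelAbove N → Schanuel` — every tail piece is the whole conjecture.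
* `D5` (the `2πi` dichotomy): `SchanuelSpanTwoPiI`, `SchanuelOffTwoPiI`, collapse
  `schanuel_of_schanuelSpanTwoPiI` — the "`2πi ∈ span`" half alone is the summit.
* `D2` (certificate calculus): `CompletenessSat` typed, with its soundness `sat_certificate_sound`.

Everything is stated over Mathlib + the route file; nothing here is a route item.
-/

noncomputable section

set_option linter.dupNamespace false

namespace Summit.Schanuel.Schanuel.Cruxes.ComputableSchanuel.Census

open Summit.Schanuel.Schanuel.Theses.ArithmeticalComplexity

/-! ## Common vocabulary -/

/-- Kirby's countable core, inlined exactly as in the route file (coordinates of non-degenerate zeros of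
square integer exponential-polynomial systems). -/
def InCore (x : ℂ) : Prop :=
  ∃ (n : ℕ) (v : Fin n → ℂ) (F : Fin n → MvPolynomial (Fin n ⊕ Fin n) ℤ), (∃ j, v j = x) ∧
    (∀ i, MvPolynomial.aeval (Sum.elim v (Complex.exp ∘ v)) (F i) = 0) ∧
    (Matrix.of fun i j => MvPolynomial.aeval (Sum.elim v (Complex.exp ∘ v))
      (MvPolynomial.pderiv (Sum.inl j) (F i) +
        MvPolynomial.X (Sum.inr j) * MvPolynomial.pderiv (Sum.inr j) (F i))).det ≠ 0

/-- Schanuel's inequality for one tuple `z`. -/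
def SchIneq {n : ℕ} (z : Fin n → ℂ) : Prop :=
  (n : Cardinal) ≤ Algebra.trdeg ℚ
    ↥(IntermediateField.adjoin ℚ (Set.range z ∪ Set.range (Complex.exp ∘ z)))

/-- Schanuel at length exactly `n`. -/
def SchanuelAt (n : ℕ) : Prop := ∀ z : Fin n → ℂ, LinearIndependent ℚ z → SchIneq z

theorem schanuel_iff_forall_schanuelAt : _root_.Schanuel ↔ ∀ n, SchanuelAt n := Iff.rfl

/-- A computable fast-Cauchy Gaussian-rational name of `x` (the route's notion). -/
def ComputableName (x : ℂ) : Prop :=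
  ∃ g : ℕ → ℚ × ℚ, Computable g ∧ ∀ m : ℕ, ‖x - (((g m).1 : ℂ) + ((g m).2 : ℂ) * Complex.I)‖ ≤ 1 / 2 ^ m

theorem computableSchanuel_iff :
    ComputableSchanuel ↔ ∀ (n : ℕ) (z : Fin n → ℂ), (∀ j, ComputableName (z j)) →
      LinearIndependent ℚ z → SchIneq z := Iff.rfl

/-- Uniform names along a sequence (the route's notion). -/
def UniformNames (a : ℕ → ℂ) : Prop :=
  ∃ f : ℕ × ℕ → ℚ × ℚ, Computable f ∧
    ∀ k m : ℕ, ‖a k - (((f (k, m)).1 : ℂ) + ((f (k, m)).2 : ℂ) * Complex.I)‖ ≤ 1 / 2 ^ m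

/-- The Z key along `a` (decidable exponential-polynomial relations; verbatim the route's clause). -/
def ZeroTest (a : ℕ → ℂ) : Prop :=
  ComputablePred fun p : List ℕ × List ((List ℕ × List ℕ) × ℤ) =>
    (p.2.map fun m => (m.2 : ℂ) * (List.zipWith (fun k e => a k ^ e) p.1 m.1.1).prod *
      (List.zipWith (fun k e => Complex.exp (a k) ^ e) p.1 m.1.2).prod).sum = 0

/-- The M key along `a` (computable height bound for ℤ-linear relations; verbatim the route's clause). -/
def RelationBound (a : ℕ → ℂ) : Prop :=
  ∃ H : List ℕ → ℕ, Computable H ∧ ∀ l : List ℕ, ¬ LinearIndependent ℚ (a ∘ l.get) →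
    ∃ c : Fin l.length → ℤ, c ≠ 0 ∧ (∀ j, (c j).natAbs ≤ H l) ∧ ∑ j, (c j : ℂ) * a (l.get j) = 0

/-- Schanuel for tuples drawn from the range of `a`. -/
def SchanuelAlong (a : ℕ → ℂ) : Prop :=
  ∀ (n : ℕ) (z : Fin n → ℂ), (∀ j, z j ∈ Set.range a) → LinearIndependent ℚ z → SchIneq z

/-! ## D1 — the keys bridge: `ComputableSchanuel ⇐ KeysZM ∧ KeysBridge (∧ KirbyCoreReduction)` -/

/-- D1 piece T: the two effective keys exist for ONE uniformly computable enumeration of the core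
(= `DecidableCoreRelations ∧ LinearRelationBound` for the same `a`). -/
def KeysZM : Prop :=
  ∃ a : ℕ → ℂ, Set.range a = {x | InCore x} ∧ UniformNames a ∧ ZeroTest a ∧ RelationBound a

/-- D1 piece T → S: under the keys, Schanuel holds along the enumeration (the Π⁰₁ form of the route's
descent `CounterexamplesRE`, read as a statement to be PROVED rather than as a complexity bound). -/
def KeysBridge : Prop :=
  ∀ a : ℕ → ℂ, Set.range a = {x | InCore x} → UniformNames a → ZeroTest a → RelationBound a →
    SchanuelAlong a

/-- (b) for D1, summit form: keys + bridge + Kirby's reduction give Schanuel (pure logic). -/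
theorem schanuel_of_keys (hK : KeysZM) (hB : KeysBridge) (hKirby : KirbyCoreReduction) :
    _root_.Schanuel := by
  obtain ⟨a, hrange, hnames, hZ, hM⟩ := hK
  have halong : SchanuelAlong a := hB a hrange hnames hZ hM
  refine hKirby.mpr fun n z hz hli => halong n z (fun j => ?_) hli
  rw [hrange]
  exact hz j

/-- (b) for D1: the assembly `KeysZM → KeysBridge → KirbyCoreReduction → ComputableSchanuel` is proved. -/
theorem computableSchanuel_of_keys (hK : KeysZM) (hB : KeysBridge) (hKirby : KirbyCoreReduction) :
    ComputableSchanuel :=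
  fun n z _ hli => schanuel_of_keys hK hB hKirby n z hli

/-- (c) for D1, first half: `KeysBridge` is a CONSEQUENCE of the summit (trivially). -/
theorem keysBridge_of_schanuel (h : _root_.Schanuel) : KeysBridge :=
  fun _ _ _ _ _ n z _ hli => h n z hli

/-- (c) for D1, second half: GIVEN the keys, `KeysBridge` is the summit (modulo the transcendence-free
support `KirbyCoreReduction`): the bridge piece carries the whole conjecture whenever `KeysZM` holds. -/
theorem keysBridge_iff_schanuel_of_keys (hK : KeysZM) (hKirby : KirbyCoreReduction) :
    KeysBridge ↔ _root_.Schanuel :=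
  ⟨fun hB => schanuel_of_keys hK hB hKirby, keysBridge_of_schanuel⟩

/-! ## D3 — complexity sub-class: `ComputableSchanuel ⇐ PrimrecSchanuel ∧ CorePrimrec (∧ KirbyCoreReduction)` -/

/-- A PRIMITIVE RECURSIVE fast-Cauchy name of `x`. -/
def PrimrecName (x : ℂ) : Prop :=
  ∃ g : ℕ → ℚ × ℚ, Primrec g ∧ ∀ m : ℕ, ‖x - (((g m).1 : ℂ) + ((g m).2 : ℂ) * Complex.I)‖ ≤ 1 / 2 ^ m

/-- D3 piece: Schanuel for tuples of numbers with primitive recursive names. -/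
def PrimrecSchanuel : Prop :=
  ∀ (n : ℕ) (z : Fin n → ℂ), (∀ j, PrimrecName (z j)) → LinearIndependent ℚ z → SchIneq z

/-- D3 piece: every core point has a primitive recursive name (true: exponential-algebraic numbers are
even polynomial-time computable — Brent 1976 / Ko 1991 — a transcendence-free fact). -/
def CorePrimrec : Prop := ∀ x : ℂ, InCore x → PrimrecName x

theorem primrecName_computableName {x : ℂ} (h : PrimrecName x) : ComputableName x := by
  obtain ⟨g, hg, hx⟩ := h
  exact ⟨g, hg.to_comp, hx⟩

/-- (b) for D3: the assembly is proved — and it is LITERALLY the shape of the route's `closes`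
(`CoreComputable → KirbyCoreReduction → ComputableSchanuel → Schanuel`) one level down. -/
theorem schanuel_of_primrec (hC : CorePrimrec) (hKirby : KirbyCoreReduction) (hP : PrimrecSchanuel) :
    _root_.Schanuel :=
  hKirby.mpr fun n z hz hli => hP n z (fun j => hC (z j) (hz j)) hli

theorem computableSchanuel_of_primrec (hC : CorePrimrec) (hKirby : KirbyCoreReduction)
    (hP : PrimrecSchanuel) : ComputableSchanuel :=
  fun n z _ hli => schanuel_of_primrec hC hKirby hP n z hli

/-- (c) for D3: the open piece is implied by `ComputableSchanuel` trivially … -/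
theorem primrecSchanuel_of_computableSchanuel (h : ComputableSchanuel) : PrimrecSchanuel :=
  fun n z hz hli => h n z (fun j => primrecName_computableName (hz j)) hli

/-- … hence, given the transcendence-free supports, `PrimrecSchanuel ⟺ ComputableSchanuel ⟺ Schanuel`:
the judge's `smuggling` verdict reproduced one level down. -/
theorem primrecSchanuel_iff_schanuel (hC : CorePrimrec) (hKirby : KirbyCoreReduction) :
    PrimrecSchanuel ↔ _root_.Schanuel :=
  ⟨schanuel_of_primrec hC hKirby, fun h => primrecSchanuel_of_computableSchanuel fun n z _ hli => h n z hli⟩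

/-! ## D4 — stratification by length: every tail piece is the whole conjecture (padding lemma) -/

/-- Schanuel for lengths `≤ N`. -/
def SchanuelUpTo (N : ℕ) : Prop := ∀ n, n ≤ N → SchanuelAt n

/-- Schanuel for lengths `> N`. -/
def SchanuelAbove (N : ℕ) : Prop := ∀ n, N < n → SchanuelAt n

theorem schanuel_iff_upTo_and_above (N : ℕ) : _root_.Schanuel ↔ SchanuelUpTo N ∧ SchanuelAbove N :=
  ⟨fun h => ⟨fun n _ => h n, fun n _ => h n⟩, fun h n => by
    rcases Nat.lt_or_ge N n with hn | hn
    · exact h.2 n hn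
    · exact h.1 n hn⟩

/-- There is an algebraic number outside the ℚ-span of any finite tuple (powers of a primitive `p`-th
root of unity, `p > n + 1` prime, are `p − 1` linearly independent algebraic numbers). [folklore] -/
theorem exists_isAlgebraic_not_mem_span {n : ℕ} (z : Fin n → ℂ) :
    ∃ α : ℂ, IsAlgebraic ℚ α ∧ α ∉ Submodule.span ℚ (Set.range z) := by
  obtain ⟨p, hp, hprime⟩ := Nat.exists_infinite_primes (n + 2)
  set ζ : ℂ := Complex.exp (2 * Real.pi * Complex.I / p) with hζdef
  have hζ : IsPrimitiveRoot ζ p := Complex.isPrimitiveRoot_exp p hprime.ne_zero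
  have hint : IsIntegral ℚ ζ := (hζ.isIntegral hprime.pos).tower_top
  have hdeg : (minpoly ℚ ζ).natDegree = p - 1 := by
    rw [← Polynomial.cyclotomic_eq_minpoly_rat hζ hprime.pos, Polynomial.natDegree_cyclotomic,
      Nat.totient_prime hprime]
  have hli : LinearIndependent ℚ fun i : Fin (minpoly ℚ ζ).natDegree => ζ ^ (i : ℕ) :=
    linearIndependent_pow (K := ℚ) ζ
  by_contra hcon
  set W : Submodule ℚ ℂ := Submodule.span ℚ (Set.range z) with hW
  have hcon' : ∀ α : ℂ, IsAlgebraic ℚ α → α ∈ W := fun α hα =>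
    by_contra fun hn => hcon ⟨α, hα, hn⟩
  have hmem : ∀ i : Fin (minpoly ℚ ζ).natDegree, ζ ^ (i : ℕ) ∈ W := fun i =>
    hcon' _ (hint.pow i).isAlgebraic
  let f : Fin (minpoly ℚ ζ).natDegree → W := fun i => ⟨ζ ^ (i : ℕ), hmem i⟩
  have hf : LinearIndependent ℚ f := by
    apply LinearIndependent.of_comp W.subtype
    exact hli
  haveI : Module.Finite ℚ W := FiniteDimensional.span_of_finite ℚ (Set.finite_range z)
  have h1 : Fintype.card (Fin (minpoly ℚ ζ).natDegree) ≤ Module.finrank ℚ W :=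
    hf.fintype_card_le_finrank
  have h2 : Module.finrank ℚ W ≤ Fintype.card (Fin n) := finrank_range_le_card z
  simp only [Fintype.card_fin, hdeg] at h1 h2
  omega

/-- `n + 1 ≤ t + 1` in `Cardinal` gives `n ≤ t` for a natural number `n`. -/
theorem natCast_le_of_succ_le_add_one {n : ℕ} {t : Cardinal.{0}}
    (h : ((n + 1 : ℕ) : Cardinal.{0}) ≤ t + 1) : (n : Cardinal.{0}) ≤ t := by
  rcases lt_or_ge t Cardinal.aleph0 with ht | ht
  · obtain ⟨m, rfl⟩ := Cardinal.lt_aleph0.mp ht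
    have h' : ((n + 1 : ℕ) : Cardinal.{0}) ≤ ((m + 1 : ℕ) : Cardinal.{0}) := by
      simpa [Nat.cast_succ] using h
    have hnm : n + 1 ≤ m + 1 := by exact_mod_cast h'
    exact_mod_cast Nat.le_of_succ_le_succ hnm
  · exact (Cardinal.natCast_lt_aleph0 (n := n)).le.trans ht

/-- Transcendence-degree bookkeeping for a padded tuple: if `β` or `e^β` is algebraic, then
`trdeg ℚ(cons β z, e^{cons β z}) ≤ trdeg ℚ(z, e^z) + 1`. [folklore] -/
theorem trdeg_cons_le {n : ℕ} (z : Fin n → ℂ) (β : ℂ)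
    (hβ : IsAlgebraic ℚ β ∨ IsAlgebraic ℚ (Complex.exp β)) :
    Algebra.trdeg ℚ ↥(IntermediateField.adjoin ℚ (Set.range (Fin.cons β z : Fin (n + 1) → ℂ) ∪
        Set.range (Complex.exp ∘ (Fin.cons β z : Fin (n + 1) → ℂ)))) ≤
      Algebra.trdeg ℚ ↥(IntermediateField.adjoin ℚ (Set.range z ∪ Set.range (Complex.exp ∘ z))) + 1 := by
  set S₀ : Set ℂ := Set.range z ∪ Set.range (Complex.exp ∘ z) with hS₀
  have hcongr : ∀ {S T : Set ℂ}, S = T →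
      Algebra.trdeg ℚ ↥(IntermediateField.adjoin ℚ S) = Algebra.trdeg ℚ ↥(IntermediateField.adjoin ℚ T) :=
    fun h => by subst h; rfl
  have h1 : Set.range (Fin.cons β z : Fin (n + 1) → ℂ) = insert β (Set.range z) := Fin.range_cons β z
  have h2 : Complex.exp ∘ (Fin.cons β z : Fin (n + 1) → ℂ) = Fin.cons (Complex.exp β) (Complex.exp ∘ z) :=
    Fin.comp_cons Complex.exp β z
  rcases hβ with hβ | hβ
  · -- `β` algebraic: drop it, `e^β` costs at most one
    have hrange : Set.range (Fin.cons β z : Fin (n + 1) → ℂ) ∪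
        Set.range (Complex.exp ∘ (Fin.cons β z : Fin (n + 1) → ℂ)) = insert (Complex.exp β) S₀ ∪ {β} := by
      rw [h2, h1, Fin.range_cons]
      ext x
      simp only [Set.mem_union, Set.mem_insert_iff, Set.mem_singleton_iff, hS₀]
      tauto
    have halg : ∀ x ∈ ({β} : Set ℂ), IsAlgebraic ℚ x := by
      intro x hx
      rw [Set.mem_singleton_iff] at hx
      subst hx
      exact hβ
    rw [hcongr hrange]
    exact (Literature.Barriers.Schanuel.trdeg_adjoin_union_eq_of_isAlgebraic _ _ halg).trans_le
      (Literature.NumberTheory.Transcendental.trdeg_adjoin_insert_le S₀ (Complex.exp β))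
  · -- `e^β` algebraic: drop it, `β` costs at most one
    have hrange : Set.range (Fin.cons β z : Fin (n + 1) → ℂ) ∪
        Set.range (Complex.exp ∘ (Fin.cons β z : Fin (n + 1) → ℂ)) = insert β S₀ ∪ {Complex.exp β} := by
      rw [h2, h1, Fin.range_cons]
      ext x
      simp only [Set.mem_union, Set.mem_insert_iff, Set.mem_singleton_iff, hS₀]
      tauto
    have halg : ∀ x ∈ ({Complex.exp β} : Set ℂ), IsAlgebraic ℚ x := by
      intro x hx
      rw [Set.mem_singleton_iff] at hx
      subst hx
      exact hβ
    rw [hcongr hrange]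
    exact (Literature.Barriers.Schanuel.trdeg_adjoin_union_eq_of_isAlgebraic _ _ halg).trans_le
      (Literature.NumberTheory.Transcendental.trdeg_adjoin_insert_le S₀ β)

/-- From Schanuel's inequality for a padded tuple back to the original tuple. -/
theorem schIneq_of_cons {n : ℕ} {z : Fin n → ℂ} {β : ℂ}
    (hβ : IsAlgebraic ℚ β ∨ IsAlgebraic ℚ (Complex.exp β)) (h : SchIneq (Fin.cons β z : Fin (n + 1) → ℂ)) :
    SchIneq z :=
  natCast_le_of_succ_le_add_one (h.trans (trdeg_cons_le z β hβ))

/-- THE PADDING LEMMA: Schanuel at length `n + 1` implies Schanuel at length `n` — adjoin an algebraic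
`α ∉ span_ℚ z`; the new tuple is ℚ-free and its transcendence degree grows by at most one (`α` is
algebraic, `e^α` is one element). Hence `SchanuelAt` is ANTITONE and every tail `SchanuelAbove N` is the
whole conjecture. [folklore] -/
theorem schanuelAt_of_succ {n : ℕ} (h : SchanuelAt (n + 1)) : SchanuelAt n := by
  intro z hz
  obtain ⟨α, hα, hαspan⟩ := exists_isAlgebraic_not_mem_span z
  have hli : LinearIndependent ℚ (Fin.cons α z : Fin (n + 1) → ℂ) :=
    linearIndependent_finCons.2 ⟨hz, hαspan⟩
  exact schIneq_of_cons (Or.inl hα) (h _ hli)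

theorem schanuelAt_of_le {m n : ℕ} (hmn : n ≤ m) (h : SchanuelAt m) : SchanuelAt n := by
  induction m, hmn using Nat.le_induction with
  | base => exact h
  | succ k _ ih => exact ih (schanuelAt_of_succ h)

/-- (c) fails for every length stratification: the tail piece alone is the summit. -/
theorem schanuel_of_schanuelAbove (N : ℕ) (h : SchanuelAbove N) : _root_.Schanuel :=
  fun n => schanuelAt_of_le (Nat.le_add_right n (N + 1)) (h (n + (N + 1)) (by omega))

theorem schanuelAbove_iff_schanuel (N : ℕ) : SchanuelAbove N ↔ _root_.Schanuel :=
  ⟨schanuel_of_schanuelAbove N, fun h n _ => h n⟩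

/-! ## D5 — the `2πi` dichotomy: the "`2πi ∈ span`" half is the whole conjecture -/

/-- D5 piece: Schanuel for tuples whose ℚ-span contains `2πi`. -/
def SchanuelSpanTwoPiI : Prop :=
  ∀ (n : ℕ) (z : Fin n → ℂ), LinearIndependent ℚ z →
    (2 * Real.pi * Complex.I : ℂ) ∈ Submodule.span ℚ (Set.range z) → SchIneq z

/-- D5 piece: Schanuel for tuples whose ℚ-span avoids `2πi`. -/
def SchanuelOffTwoPiI : Prop :=
  ∀ (n : ℕ) (z : Fin n → ℂ), LinearIndependent ℚ z →
    (2 * Real.pi * Complex.I : ℂ) ∉ Submodule.span ℚ (Set.range z) → SchIneq z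

theorem schanuel_iff_spanTwoPiI_and_off : _root_.Schanuel ↔ SchanuelSpanTwoPiI ∧ SchanuelOffTwoPiI :=
  ⟨fun h => ⟨fun n z hz _ => h n z hz, fun n z hz _ => h n z hz⟩, fun h n z hz => by
    by_cases hmem : (2 * Real.pi * Complex.I : ℂ) ∈ Submodule.span ℚ (Set.range z)
    · exact h.1 n z hz hmem
    · exact h.2 n z hz hmem⟩

/-- (c) fails for the `2πi` dichotomy: the "`2πi ∈ span`" piece alone is the summit (pad a tuple avoiding
`2πi` with `2πi` itself: `e^{2πi} = 1` is algebraic, so the transcendence degree grows by at most one). -/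
theorem schanuel_of_schanuelSpanTwoPiI (h : SchanuelSpanTwoPiI) : _root_.Schanuel := by
  intro n z hz
  by_cases hmem : (2 * Real.pi * Complex.I : ℂ) ∈ Submodule.span ℚ (Set.range z)
  · exact h n z hz hmem
  · have hli : LinearIndependent ℚ (Fin.cons (2 * Real.pi * Complex.I : ℂ) z : Fin (n + 1) → ℂ) :=
      linearIndependent_finCons.2 ⟨hz, hmem⟩
    have hspan : (2 * Real.pi * Complex.I : ℂ) ∈
        Submodule.span ℚ (Set.range (Fin.cons (2 * Real.pi * Complex.I : ℂ) z : Fin (n + 1) → ℂ)) :=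
      Submodule.subset_span ⟨0, by simp⟩
    have halg : IsAlgebraic ℚ (Complex.exp (2 * Real.pi * Complex.I)) := by
      rw [Complex.exp_two_pi_mul_I]
      exact isAlgebraic_one
    exact schIneq_of_cons (Or.inr halg) (h _ _ hli hspan)

theorem schanuelSpanTwoPiI_iff_schanuel : SchanuelSpanTwoPiI ↔ _root_.Schanuel :=
  ⟨schanuel_of_schanuelSpanTwoPiI, fun h n z hz _ => h n z hz⟩

/-! ## D2 — certificate calculus: completeness of the saturation calculus (typed; analysed on paper) -/

/-- D2 piece X₁ (COMPLETENESS of the saturation calculus 𝒦_sat on ℚ-free non-degenerate solutions):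
every integer polynomial relation `P(v, e^v) = 0` at a non-degenerate zero `v` (ℚ-linearly independent
coordinates) of a square integer system `F` is CERTIFIED by `(h·P)^k ∈ (F)` for some `h` with
`h(v, e^v) ≠ 0` — i.e. `P` vanishes on the component of `V(F)` through the point.  Equivalent, by
transversality (the point is a smooth point of `V(F)`, local dimension `n`), to "the point is
Zariski-generic on its component", i.e. to `trdeg ℚ(v, e^v) = n` = `DiophantineDichotomy.KhovanskiiSchanuel`,
which is ⟺ Schanuel by the LANDED `khovanskiiReduction_proof` and the trivial converse. -/
def CompletenessSat : Prop :=
  ∀ (n : ℕ) (v : Fin n → ℂ) (F : Fin n → MvPolynomial (Fin n ⊕ Fin n) ℤ), LinearIndependent ℚ v →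
    (∀ i, MvPolynomial.aeval (Sum.elim v (Complex.exp ∘ v)) (F i) = 0) →
    (Matrix.of fun i j => MvPolynomial.aeval (Sum.elim v (Complex.exp ∘ v))
      (MvPolynomial.pderiv (Sum.inl j) (F i) +
        MvPolynomial.X (Sum.inr j) * MvPolynomial.pderiv (Sum.inr j) (F i))).det ≠ 0 →
    ∀ P : MvPolynomial (Fin n ⊕ Fin n) ℤ, MvPolynomial.aeval (Sum.elim v (Complex.exp ∘ v)) P = 0 →
      ∃ (h : MvPolynomial (Fin n ⊕ Fin n) ℤ) (k : ℕ),
        MvPolynomial.aeval (Sum.elim v (Complex.exp ∘ v)) h ≠ 0 ∧ (h * P) ^ k ∈ Ideal.span (Set.range F)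

/-- Soundness of a saturation certificate: `(h·P)^k ∈ (F)`, `F(p) = 0`, `h(p) ≠ 0` force `P(p) = 0`
(so the calculus only ever certifies TRUE relations; completeness is the open, Schanuel-strength half). -/
theorem sat_certificate_sound {n : ℕ} (p : Fin n ⊕ Fin n → ℂ) (F : Fin n → MvPolynomial (Fin n ⊕ Fin n) ℤ)
    (hF : ∀ i, MvPolynomial.aeval p (F i) = 0) (P h : MvPolynomial (Fin n ⊕ Fin n) ℤ) (k : ℕ)
    (hh : MvPolynomial.aeval p h ≠ 0) (hmem : (h * P) ^ k ∈ Ideal.span (Set.range F)) :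
    MvPolynomial.aeval p P = 0 := by
  have hvan : ∀ Q ∈ Ideal.span (Set.range F), MvPolynomial.aeval p Q = 0 := by
    intro Q hQ
    refine Submodule.span_induction (p := fun Q _ => MvPolynomial.aeval p Q = 0) ?_ ?_ ?_ ?_ hQ
    · rintro _ ⟨i, rfl⟩; exact hF i
    · simp
    · intro x y _ _ hx hy; simp [hx, hy]
    · intro a x _ hx; simp [hx]
  have := hvan _ hmem
  rw [map_pow, map_mul] at this
  exact (mul_eq_zero.mp (pow_eq_zero_iff'.mp this).1).resolve_left hh

end Summit.Schanuel.Schanuel.Cruxes.ComputableSchanuel.Census
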